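import Literature.AnabelianGeometry.AbsoluteAnabelian.AbsTopII.InertiaGroupsCuspScopeProofs
import Literature.AnabelianGeometry.AbsoluteAnabelian.AbsTopII.Prop13SmoothCurveModel

/-!
# [AbsTopII] Prop 1.3 (iii) with the printed conjugacy scope (`Prop_1_3_iii''`): NON-VACUITY at a datum WITH CUSPS

S. Mochizuki, *Topics in Absolute Anabelian Geometry II* [AbsTopII] (bib `MochizukiAbsTopII2013`;
locators = PDF pages of the kurims manuscript `paper:url-585b8d0ad0d9`), §1, Def 1.2 (ii) p. 10,
Prop 1.3 (iii) p. 11.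

PROOF-ONLY (no definition), abc-iut-L4-t6 lineage (typer of record of `DPSCIndexData.Prop_1_3_iii''`,
`AbsTopII/InertiaGroupsCuspScope.lean` p442458).  The procyclic non-vacuity model of this lineage's v1
predicate (`AbsTopII/Prop13ProcyclicModel.lean`) has NO cusps, so the cusp clause — the clause whose scope
v2 repairs — is vacuous there.  abc-iut-f-066's SMOOTH-CURVE-SHAPE model WITH `r ≥ 1` CUSPS
(`DPSCIndexData.exists_smoothCurve_product_model`, `AbsTopII/Prop13SmoothCurveModel.lean` p446583:
`Π_𝔾 = Π_v` a pro-`Σ` completion of a hyperbolic `Γ_{g,r}`, `Π_H = Π_I = Π_𝔾 × Ẑ^Σ`, cusps the closed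
cusp-inertia images) exposes exactly the binder package of `prop_1_3_iii''_of_vertSub_eq_PiG`
([CombGC] Prop 1.2 (ii) for `Π_v`, `Π_e`; slimness of `Π_v`; `I_v ↠ I`; `I_v ≅ Ẑ^Σ`; `Π_v = Π_𝔾`), so:

* `exists_smoothCurve_model_prop_1_3_iii''` — for every nonempty set of primes `Σ` and every hyperbolic
  type `(g, r)` with `r ≥ 1` there is DPSC-index data with `Σ`, `r` cusps, no node, `Π_v = Π_𝔾`, at which
  `Prop_1_3_iii''` (hence `Prop_1_3_iii'`) HOLDS — the cusp clause NON-vacuously, with the `Π_𝔾`-conjugate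
  `γ = 1`;
* `exists_tripodType_model_prop_1_3_iii''` — the instance `Σ = {2}`, `(g, r) = (0, 3)`.

HONEST FRAMING: a constructed group-theoretic model (constructed ≠ geometric; f-066's honest label
applies); non-vacuity evidence for FACT-LIST successor row F-0299 → `Prop_1_3_iii''`; typed ≠ proved;
nothing here bears on [IUTchIII] Cor 3.12.
-/

namespace Literature.AnabelianGeometry.AbsoluteAnabelian.AbsTopII.DPSCIndexData

open Literature.GroupTheory.CombinatorialGroupTheory

/-- **`Prop_1_3_iii''` holds at DPSC data WITH CUSPS** (f-066's smooth-curve-shape model: `Σ` any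
nonempty set of primes, `(g, r)` hyperbolic with `r ≥ 1`): the data have `Σ`, `r` cusps, no node and
`Π_v = Π_𝔾`, and satisfy the v2 predicate (cusp clause with `γ = 1 ∈ Π_𝔾`) and therefore the v1
predicate. [cite: MochizukiAbsTopII2013, Prop 1.3 (iii) p.11] -/
theorem exists_smoothCurve_model_prop_1_3_iii'' (Sigma : Set ℕ) (hS₁ : Sigma.Nonempty)
    (hS₂ : ∀ p ∈ Sigma, p.Prime) (g r : ℕ) (hgr : PuncturedSurfaceGroup.IsHyperbolicType g r)
    (hr : 0 < r) :
    ∃ X : DPSCIndexData.{0}, X.Sigma = Sigma ∧ Nonempty (X.Cusp ≃ Fin r) ∧ IsEmpty X.Node ∧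
      (∀ v, X.vertSub v = X.PiG) ∧
      Literature.AnabelianGeometry.AbsoluteAnabelian.AbsTopII.DPSCIndexData.Prop_1_3_iii'' X ∧
      Literature.AnabelianGeometry.AbsoluteAnabelian.AbsTopII.DPSCIndexData.Prop_1_3_iii' X := by
  obtain ⟨Q, ι₀, hι₀, Z, hZ, G, hιr, hιn, X, -, -, -, -, -, -, -, -, -, -, -, -, -, hXS, -, hXc, hXn,
    -, -, -, hvs, -, -, -, hCTv, hCTc, hslim, hsurj, hcyc, -⟩ :=
    exists_smoothCurve_product_model Sigma hS₁ hS₂ g r hgr hr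
  have h : X.Prop_1_3_iii'' := X.prop_1_3_iii''_of_vertSub_eq_PiG hCTv hCTc hslim hsurj hcyc hvs
  exact ⟨X, hXS, hXc, hXn, hvs, h, X.prop_1_3_iii'_of_prop_1_3_iii'' h⟩

/-- The instance of tripod type: `Σ = {2}`, `(g, r) = (0, 3)` — DPSC-index data with three cusps at
which `Prop_1_3_iii''` holds. [cite: MochizukiAbsTopII2013, Prop 1.3 (iii) p.11] -/
theorem exists_tripodType_model_prop_1_3_iii'' :
    ∃ X : DPSCIndexData.{0}, X.Sigma = {2} ∧ Nonempty (X.Cusp ≃ Fin 3) ∧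
      Literature.AnabelianGeometry.AbsoluteAnabelian.AbsTopII.DPSCIndexData.Prop_1_3_iii'' X := by
  obtain ⟨X, hS, hc, -, -, h, -⟩ := exists_smoothCurve_model_prop_1_3_iii'' {2}
    (Set.singleton_nonempty 2) (fun p hp => by rw [Set.mem_singleton_iff.mp hp]; exact Nat.prime_two)
    0 3 (by unfold PuncturedSurfaceGroup.IsHyperbolicType; norm_num) (by norm_num)
  exact ⟨X, hS, hc, h⟩

end Literature.AnabelianGeometry.AbsoluteAnabelian.AbsTopII.DPSCIndexData
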